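import Mathlib
import Literature.MathematicalPhysics.StatisticalMechanics.BarlowStacking
import Summits.AtomisticToContinuum.Crystallization.Theorems.SquareWellLayerCakeStackingFaultSparsityDefs
import Summits.AtomisticToContinuum.Crystallization.Theorems.ReggeStarCoercivityDefectFreeCrystallizesLayeredGluing07

/-!
# The block-shift competitor is injective (stub `stub_competitorInjective`, line `Sketch`)

Crux `StackingFaultSparsity` (item stmt-AtomisticToContinuum-14296, routes `SquareWellLayerCake` /
`LaminarSixThreeThree`), survey obligation M3a of the dilute-faults reshape: for a window of
particle `i` of `x` two-way `(L, ε₁)`-matched to `barlowStacking a h s` based at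
`z = barlowPos a h s k i₀ j₀` after the isometry `A`, the restacking competitor
`x + blockShift …` (the particles shadowing the cylinder of the block `(q₁, q₂)` moved rigidly by
`A (σ_n • w)`) is injective, provided the box parameters `InBox a h`, `0 < ε₁ < 1/8` and the
cylinder sits `≥ 2` inside the window.

Proof (pure geometry).  Write `img p = x i + A (p - z)`.  Let `u ≠ v` collide.
* If the two displacements agree, `x u = x v`: contradiction with the injectivity of `x`.
* If both are displaced, by `A (σ • w)` and `A (σ' • w)` with `σ ≠ σ'`, their cylinder points
  `p`, `p'` lie in different layers, `x u + A (σ • w)` is within `ε₁` of `img (p + σ • w)` and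
  `x v + A (σ' • w)` within `ε₁` of `img (p' + σ' • w)`, so
  `dist (p + σ • w) (p' + σ' • w) ≤ 2 ε₁ < 1/4 < h`, while two points of different layer planes
  are `≥ h` apart.
* If only `u` is displaced (`σ = ±1`), `x v = x u + A (σ • w)` is within `ε₁` of the image of the
  HOLE `p + σ • w` of the layer of `p`.  Either `x v` is within `L` of `x i`: then (second matching
  clause) it is within `ε₁` of the image of a stacking point, at distance `> 1/4` from every hole
  (`a²/3`-separation in the layer, `h`-separation across layers); or it is beyond `L`: impossible,
  the cylinder point `p` being within `L - 2` of `z` and `‖w‖ + ε₁ < 1`.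
-/

noncomputable section
namespace Summit.AtomisticToContinuum.Crystallization.Theorems.SquareWellLayerCake.StackingFaultSparsity
open Literature.MathematicalPhysics.StatisticalMechanics
/-- Euclidean `3`-space. [folklore] -/
local notation "E3" => EuclideanSpace ℝ (Fin 3)

/-! ## Coordinates of the registry offset `w` -/

/-- `w 0 = a / 2`. [folklore] -/
theorem barlowOffset_apply_zero (a : ℝ) : barlowOffset a 0 = a / 2 := by
  simp [barlowOffset]

/-- `w 1 = a √3 / 6`. [folklore] -/
theorem barlowOffset_apply_one (a : ℝ) : barlowOffset a 1 = a * √3 / 6 := by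
  simp [barlowOffset]

/-- `w 2 = 0`: the registry offset is horizontal. [folklore] -/
theorem barlowOffset_apply_two (a : ℝ) : barlowOffset a 2 = 0 := by
  simp [barlowOffset]

/-- `‖σ • w‖ ≤ 3/5` for `σ = ±1` (indeed `|σ| ≤ 1`) and `0 ≤ a ≤ 1` (`‖w‖² = a²/3`, the landed
`PrestressSplitKorn.norm_sq_barlowOffset`). [folklore] -/
theorem norm_smul_barlowOffset_le {a : ℝ} (ha0 : 0 ≤ a) (ha1 : a ≤ 1) {σ : ℤ}
    (hσ : σ = 1 ∨ σ = -1) : ‖(σ : ℝ) • barlowOffset a‖ ≤ 3 / 5 := by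
  have hσ1 : ‖(σ : ℝ)‖ = 1 := by
    rcases hσ with rfl | rfl <;> simp
  rw [norm_smul, hσ1, one_mul]
  have h1 : ‖barlowOffset a‖ ^ 2 ≤ (3 / 5) ^ 2 := by
    rw [Crystallization.Theorems.PrestressSplitKorn.norm_sq_barlowOffset]
    nlinarith
  exact (pow_le_pow_iff_left₀ (norm_nonneg _) (by norm_num) two_ne_zero).1 h1

/-! ## Shifted stacking points in coordinates -/

/-- Squared distance of two in-plane shifted stacking points `p + σ w`, `p' + σ' w`. [folklore] -/
theorem dist_barlowPos_add_smul_sq (a h : ℝ) (s : ℤ → ℤ) (σ σ' : ℝ) (n e f n' e' f' : ℤ) :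
    dist (barlowPos a h s n e f + σ • barlowOffset a)
        (barlowPos a h s n' e' f' + σ' • barlowOffset a) ^ 2 =
      (a * ((e - e') + (f - f') / 2 + (haggLabel s n - haggLabel s n' + (σ - σ')) / 2)) ^ 2 +
      (a * √3 / 2 * ((f - f') + (haggLabel s n - haggLabel s n' + (σ - σ')) / 3)) ^ 2 +
      ((n - n') * h) ^ 2 := by
  rw [EuclideanSpace.dist_sq_eq, Fin.sum_univ_three, Real.dist_eq, Real.dist_eq, Real.dist_eq,
    sq_abs, sq_abs, sq_abs]
  simp only [PiLp.add_apply, PiLp.smul_apply, smul_eq_mul, barlowPos_apply_zero,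
    barlowPos_apply_one, barlowPos_apply_two, barlowOffset_apply_zero, barlowOffset_apply_one,
    barlowOffset_apply_two]
  ring

/-- Shifted points of DIFFERENT layers are `≥ h` apart (`0 ≤ h`). [folklore] -/
theorem le_dist_barlowPos_add_smul_of_ne {a h : ℝ} (hh : 0 ≤ h) (s : ℤ → ℤ) (σ σ' : ℝ)
    {n n' : ℤ} (hn : n ≠ n') (e f e' f' : ℤ) :
    h ≤ dist (barlowPos a h s n e f + σ • barlowOffset a)
      (barlowPos a h s n' e' f' + σ' • barlowOffset a) := by
  have h1 : (1 : ℝ) ≤ ((n : ℝ) - n') ^ 2 := by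
    have : (1 : ℤ) ≤ (n - n') ^ 2 := by
      have h0 : n - n' ≠ 0 := sub_ne_zero.2 hn
      nlinarith [Int.one_le_abs h0, sq_abs (n - n')]
    exact_mod_cast this
  have h2 : h ^ 2 ≤ dist (barlowPos a h s n e f + σ • barlowOffset a)
      (barlowPos a h s n' e' f' + σ' • barlowOffset a) ^ 2 := by
    rw [dist_barlowPos_add_smul_sq]
    nlinarith [sq_nonneg (a * ((e - e') + (f - f') / 2 +
        (haggLabel s n - haggLabel s n' + (σ - σ')) / 2)),
      sq_nonneg (a * √3 / 2 * ((f - f') + (haggLabel s n - haggLabel s n' + (σ - σ')) / 3)),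
      sq_nonneg h]
  exact (pow_le_pow_iff_left₀ hh dist_nonneg two_ne_zero).1 h2

/-- The integer quadratic form of the hole distance is `≥ 0`: `X² + XY + Y² ± (X + Y) ≥ 0` on `ℤ²`
(`4 (3 m + 1) = 3 (2X + Y + σ)² + (3Y + σ)²` and `3Y + σ ≠ 0`). [folklore] -/
theorem hole_form_nonneg (X Y : ℤ) {σ : ℤ} (hσ : σ = 1 ∨ σ = -1) :
    0 ≤ X ^ 2 + X * Y + Y ^ 2 + σ * (X + Y) := by
  rcases hσ with rfl | rfl
  · nlinarith [sq_nonneg (2 * X + Y + 1), sq_nonneg (3 * Y + 1)]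
  · nlinarith [sq_nonneg (2 * X + Y - 1), sq_nonneg (3 * Y - 1)]

/-- **Holes are far from sites**: for box parameters, the hole `p + σ w` (`σ = ±1`) of the layer of
the stacking point `p` is at distance `> 1/4` from every stacking point (`≥ a/√3` within the layer,
`≥ h` across layers). [folklore] -/
theorem quarter_lt_dist_hole {a h : ℝ} (hbox : InBox a h) (s : ℤ → ℤ) {σ : ℤ} (hσ : σ = 1 ∨ σ = -1)
    (n e f n' e' f' : ℤ) :
    1 / 4 < dist (barlowPos a h s n e f + (σ : ℝ) • barlowOffset a) (barlowPos a h s n' e' f') := by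
  obtain ⟨ha0, -, hh0, -⟩ := hbox
  have hh : 0 ≤ h := by linarith
  have key : (1 / 4 : ℝ) ^ 2 < dist (barlowPos a h s n e f + (σ : ℝ) • barlowOffset a)
      (barlowPos a h s n' e' f') ^ 2 := by
    by_cases hn : n = n'
    · subst hn
      have h3 : (√3 : ℝ) ^ 2 = 3 := Real.sq_sqrt (by norm_num)
      have hσ2 : (σ : ℝ) ^ 2 = 1 := by rcases hσ with rfl | rfl <;> norm_num
      have hm : (0 : ℝ) ≤ ((e - e') ^ 2 + (e - e') * (f - f') + (f - f') ^ 2 +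
          σ * ((e - e') + (f - f')) : ℤ) := by exact_mod_cast hole_form_nonneg (e - e') (f - f') hσ
      have hrepr : dist (barlowPos a h s n e f + (σ : ℝ) • barlowOffset a)
          (barlowPos a h s n e' f') ^ 2 =
          a ^ 2 * ((e - e') ^ 2 + (e - e') * (f - f') + (f - f') ^ 2 +
            σ * ((e - e') + (f - f')) : ℤ) + a ^ 2 / 3 := by
        have h0 := dist_barlowPos_add_smul_sq a h s σ 0 n e f n e' f'
        rw [zero_smul, add_zero] at h0
        rw [h0]
        push_cast
        linear_combination (a ^ 2 / 4 * (((f : ℝ) - f') + (σ : ℝ) / 3) ^ 2) * h3 +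
          (a ^ 2 / 3) * hσ2
      rw [hrepr]
      nlinarith [mul_nonneg (sq_nonneg a) hm]
    · have h1 := le_dist_barlowPos_add_smul_of_ne (a := a) hh s (σ : ℝ) 0 hn e f e' f'
      rw [zero_smul, add_zero] at h1
      have h14 : (1 / 4 : ℝ) < h := by linarith
      have : (1 / 4 : ℝ) < dist (barlowPos a h s n e f + (σ : ℝ) • barlowOffset a)
          (barlowPos a h s n' e' f') := lt_of_lt_of_le h14 h1
      exact pow_lt_pow_left₀ this (by norm_num) two_ne_zero
  exact lt_of_pow_lt_pow_left₀ 2 dist_nonneg key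

/-! ## The cylinder and the displacement field -/

/-- A cylinder point is within `ρ + (q₂ - q₁) h` of the cylinder base point. [folklore] -/
theorem dist_le_of_inCyl {a h : ℝ} (hh : 0 ≤ h) {s : ℤ → ℤ} {q₁ q₂ i₀ j₀ : ℤ} {ρ : ℝ} (hρ : 0 ≤ ρ)
    {n e f : ℤ} (hc : InCyl a h s q₁ q₂ i₀ j₀ ρ n e f) :
    dist (barlowPos a h s n e f) (barlowPos a h s q₁ i₀ j₀) ≤ ρ + ((q₂ : ℝ) - q₁) * h := by
  obtain ⟨h1, h2, h3⟩ := hc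
  have hsq : dist (barlowPos a h s n e f) (barlowPos a h s q₁ i₀ j₀) ^ 2 =
      latSq (barlowPos a h s n e f) (barlowPos a h s q₁ i₀ j₀) + (((n : ℝ) - q₁) * h) ^ 2 := by
    rw [EuclideanSpace.dist_sq_eq, Fin.sum_univ_three, Real.dist_eq, Real.dist_eq, Real.dist_eq,
      sq_abs, sq_abs, sq_abs, latSq, barlowPos_apply_two, barlowPos_apply_two]
    ring
  have hq1 : (0 : ℝ) ≤ (n : ℝ) - q₁ := by
    have : (q₁ : ℝ) < n := by exact_mod_cast h1
    linarith
  have hq2 : (n : ℝ) - q₁ ≤ (q₂ : ℝ) - q₁ := by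
    have : (n : ℝ) < q₂ := by exact_mod_cast h2
    linarith
  have hK : 0 ≤ ((q₂ : ℝ) - q₁) * h := mul_nonneg (hq1.trans hq2) hh
  have hle : dist (barlowPos a h s n e f) (barlowPos a h s q₁ i₀ j₀) ^ 2 ≤
      (ρ + ((q₂ : ℝ) - q₁) * h) ^ 2 := by
    rw [hsq]
    have : (((n : ℝ) - q₁) * h) ^ 2 ≤ (((q₂ : ℝ) - q₁) * h) ^ 2 :=
      pow_le_pow_left₀ (mul_nonneg hq1 hh) (mul_le_mul_of_nonneg_right hq2 hh) 2
    nlinarith [mul_nonneg hρ hK]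
  exact (pow_le_pow_iff_left₀ dist_nonneg (add_nonneg hρ hK) two_ne_zero).1 hle

/-- The registry sign is `0`, `1` or `-1`. [folklore] -/
theorem shiftSign_cases (s : ℤ → ℤ) (q₁ n : ℤ) :
    shiftSign s q₁ n = 0 ∨ (shiftSign s q₁ n = 1 ∨ shiftSign s q₁ n = -1) := by
  unfold shiftSign; omega

/-- **The two cases of `blockShift`**: either particle `j` shadows a cylinder point
`p = barlowPos a h s n e f` (within `ε₁` of its image) and is moved by `A (σ_n • w)`, or it shadows
no cylinder point and stays. [folklore] -/
theorem blockShift_cases (a h : ℝ) (s : ℤ → ℤ) (k i₀ j₀ q₁ q₂ : ℤ) (ρ ε₁ : ℝ) {N : ℕ}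
    (x : Fin N → E3) (i : Fin N) (A : E3 →ₗᵢ[ℝ] E3) (j : Fin N) :
    (∃ n e f : ℤ, InCyl a h s q₁ q₂ i₀ j₀ ρ n e f ∧
        dist (x j) (x i + A (barlowPos a h s n e f - barlowPos a h s k i₀ j₀)) ≤ ε₁ ∧
        blockShift a h s k i₀ j₀ q₁ q₂ ρ ε₁ x i A j = A ((shiftSign s q₁ n : ℝ) • barlowOffset a)) ∨
      ((∀ n e f : ℤ, InCyl a h s q₁ q₂ i₀ j₀ ρ n e f →
          ε₁ < dist (x j) (x i + A (barlowPos a h s n e f - barlowPos a h s k i₀ j₀))) ∧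
        blockShift a h s k i₀ j₀ q₁ q₂ ρ ε₁ x i A j = 0) := by
  classical
  unfold blockShift
  split_ifs with hj
  · obtain ⟨e, f, hc, hd⟩ := hj.choose_spec
    exact Or.inl ⟨_, e, f, hc, hd, rfl⟩
  · refine Or.inr ⟨fun n e f hc => ?_, rfl⟩
    by_contra hlt
    exact hj ⟨n, e, f, hc, not_lt.1 hlt⟩

/-- Images of points under the window chart `p ↦ x₀ + A (p - z)` keep their distances. [folklore] -/
theorem dist_chart_eq (x₀ z P Q : E3) (A : E3 →ₗᵢ[ℝ] E3) :
    dist (x₀ + A (P - z)) (x₀ + A (Q - z)) = dist P Q := by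
  rw [dist_add_left, LinearIsometry.dist_map, dist_sub_right]

/-- Moving a particle and its shadowed point by the same vector keeps the shadowing distance.
[folklore] -/
theorem dist_add_chart_eq (y x₀ z p t : E3) (A : E3 →ₗᵢ[ℝ] E3) :
    dist (y + A t) (x₀ + A (p + t - z)) = dist y (x₀ + A (p - z)) := by
  rw [show p + t - z = (p - z) + t by abel, map_add, ← add_assoc, dist_add_right]

/-- **The displacement of a shadowing particle**: if `x j` is within `ε₁` of the image of the
cylinder point `barlowPos a h s n e f`, then `blockShift … j = A (σ_n • w)` — whichever shadowed
cylinder point the definition chooses, it is within `2 ε₁ < 1/4 < h` of this one, hence in the same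
layer, and the registry sign only depends on the layer. [folklore] -/
theorem blockShift_eq_of_near {a h : ℝ} {s : ℤ → ℤ} {k i₀ j₀ q₁ q₂ : ℤ} {ρ ε₁ : ℝ} {N : ℕ}
    {x : Fin N → E3} {i : Fin N} {A : E3 →ₗᵢ[ℝ] E3} (hbox : InBox a h) (hε : ε₁ < 1 / 8)
    {j : Fin N} {n e f : ℤ} (hc : InCyl a h s q₁ q₂ i₀ j₀ ρ n e f)
    (hd : dist (x j) (x i + A (barlowPos a h s n e f - barlowPos a h s k i₀ j₀)) ≤ ε₁) :
    blockShift a h s k i₀ j₀ q₁ q₂ ρ ε₁ x i A j = A ((shiftSign s q₁ n : ℝ) • barlowOffset a) := by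
  obtain ⟨ha0, -, hh0, -⟩ := hbox
  have hh : 0 ≤ h := by linarith
  rcases blockShift_cases a h s k i₀ j₀ q₁ q₂ ρ ε₁ x i A j with
    ⟨n', e', f', -, hd', hb⟩ | ⟨hfar, -⟩
  · rw [hb]
    by_contra hne
    have hnn : n' ≠ n := fun h0 => hne (by rw [h0])
    have h1 : dist (barlowPos a h s n' e' f') (barlowPos a h s n e f) ≤ 2 * ε₁ := by
      rw [← dist_chart_eq (x i) (barlowPos a h s k i₀ j₀) _ _ A]
      linarith [dist_triangle_left (x i + A (barlowPos a h s n' e' f' - barlowPos a h s k i₀ j₀))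
        (x i + A (barlowPos a h s n e f - barlowPos a h s k i₀ j₀)) (x j)]
    have h2 := le_dist_barlowPos_of_layer_ne a h s hh hnn e' f' e f
    linarith
  · exact absurd hd (not_le.2 (hfar n e f hc))

/-! ## The one-sided collision -/

/-- **No one-sided collision**: a particle `u` shadowing the cylinder point `p` cannot be moved by a
genuine registry shift `A (σ • w)`, `σ = ±1`, onto another particle `x v`: if `x v` is within `L` of
`x i` it shadows a stacking point, which is `> 1/4 > 2 ε₁` from the hole `p + σ w`; if not, it is
out of reach, the cylinder sitting `≥ 2` inside the window. [folklore] -/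
theorem no_oneSided_collision {a h : ℝ} {s : ℤ → ℤ} {k i₀ j₀ q₁ q₂ : ℤ} {ρ ε₁ L : ℝ} {N : ℕ}
    {x : Fin N → E3} {i : Fin N} {A : E3 →ₗᵢ[ℝ] E3} (hbox : InBox a h) (hε : ε₁ < 1 / 8)
    (hρ : 0 ≤ ρ)
    (hL : dist (barlowPos a h s q₁ i₀ j₀) (barlowPos a h s k i₀ j₀) + ((q₂ : ℝ) - q₁) * h + ρ + 2 ≤
      L)
    (hT : TwoWay (barlowStacking a h s) L ε₁ x i (barlowPos a h s k i₀ j₀) A)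
    {u v : Fin N} {n e f : ℤ} (hc : InCyl a h s q₁ q₂ i₀ j₀ ρ n e f)
    (hd : dist (x u) (x i + A (barlowPos a h s n e f - barlowPos a h s k i₀ j₀)) ≤ ε₁)
    {σ : ℤ} (hσ : σ = 1 ∨ σ = -1) (heq : x u + A ((σ : ℝ) • barlowOffset a) = x v) : False := by
  have hbox' := hbox
  obtain ⟨ha0, ha1, hh0, -⟩ := hbox'
  have hh : 0 ≤ h := by linarith
  set z := barlowPos a h s k i₀ j₀ with hz
  set p := barlowPos a h s n e f with hp
  set t : E3 := (σ : ℝ) • barlowOffset a with ht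
  -- `x v` shadows the hole `p + t`
  have h1 : dist (x v) (x i + A (p + t - z)) ≤ ε₁ := by
    rw [← heq, dist_add_chart_eq]; exact hd
  by_cases hv : dist (x v) (x i) ≤ L
  · obtain ⟨p', hp', h2⟩ := hT.2 v hv
    obtain ⟨n', e', f', rfl⟩ := hp'
    have h3 : dist (p + t) (barlowPos a h s n' e' f') ≤ 2 * ε₁ :=
      calc dist (p + t) (barlowPos a h s n' e' f')
            = dist (x i + A (p + t - z)) (x i + A (barlowPos a h s n' e' f' - z)) :=
              (dist_chart_eq _ _ _ _ _).symm
        _ ≤ dist (x i + A (p + t - z)) (x v) +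
              dist (x v) (x i + A (barlowPos a h s n' e' f' - z)) := dist_triangle _ _ _
        _ ≤ ε₁ + ε₁ := add_le_add (by rw [dist_comm]; exact h1) h2
        _ = 2 * ε₁ := by ring
    have h4 := quarter_lt_dist_hole hbox s hσ n e f n' e' f'
    rw [← hp, ← ht] at h4
    linarith
  · push Not at hv
    have hw : ‖A t‖ ≤ 3 / 5 := by
      rw [LinearIsometry.norm_map]; exact norm_smul_barlowOffset_le (by linarith) ha1 hσ
    have hpz : dist p z ≤ L - 2 := by
      have h5 := dist_le_of_inCyl (a := a) hh hρ hc
      have h6 := dist_triangle p (barlowPos a h s q₁ i₀ j₀) z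
      rw [← hp] at h5
      linarith
    have h7 : dist (x v) (x i) ≤ ‖A t‖ + ε₁ + dist p z :=
      calc dist (x v) (x i)
            ≤ dist (x v) (x u) + dist (x u) (x i + A (p - z)) + dist (x i + A (p - z)) (x i) :=
              dist_triangle4 _ _ _ _
        _ = ‖A t‖ + dist (x u) (x i + A (p - z)) + dist p z := by
              rw [← heq, dist_self_add_left, dist_self_add_left, A.norm_map (p - z),
                ← dist_eq_norm]
        _ ≤ ‖A t‖ + ε₁ + dist p z := by rw [hp, hz]; linarith [hd]
    linarith

/-! ## The stub -/

/-- **Stub `stub_competitorInjective`** (M, geometry; survey M3a): the block-shift competitor of a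
matched window is injective (box parameters: holes `≥ a/√3 ≥ 0.54 > 2ε₁` from sites, layers `≥ h`
apart; the cylinder sits `≥ 2` inside the window — stated through the TRUE distance of the cylinder
base from the window base, which absorbs the lateral `haggLabel` drift of the `barlowPos` indexing).
[folklore] -/
theorem stub_competitorInjective :
    (∀ (a h : ℝ) (s : ℤ → ℤ) (k i₀ j₀ q₁ q₂ : ℤ) (ρ ε₁ L : ℝ) {N : ℕ} (x : Fin N → E3) (i : Fin N)
      (A : E3 →ₗᵢ[ℝ] E3), InBox a h → IsHaggSeq s → 0 < ε₁ → ε₁ < 1 / 8 → 0 ≤ ρ →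
      dist (barlowPos a h s q₁ i₀ j₀) (barlowPos a h s k i₀ j₀) + ((q₂ : ℝ) - q₁) * h + ρ + 2 ≤ L →
      Function.Injective x →
      TwoWay (barlowStacking a h s) L ε₁ x i (barlowPos a h s k i₀ j₀) A →
      Function.Injective (x + blockShift a h s k i₀ j₀ q₁ q₂ ρ ε₁ x i A)) := by
  intro a h s k i₀ j₀ q₁ q₂ ρ ε₁ L N x i A hbox _hs _hε₀ hε hρ hL hx hT u v huv
  by_contra hne
  simp only [Pi.add_apply] at huv
  have hh : 0 ≤ h := by obtain ⟨ha0, -, hh0, -⟩ := hbox; linarith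
  by_cases hd :
      blockShift a h s k i₀ j₀ q₁ q₂ ρ ε₁ x i A u = blockShift a h s k i₀ j₀ q₁ q₂ ρ ε₁ x i A v
  · rw [hd] at huv
    exact hne (hx (add_right_cancel huv))
  rcases blockShift_cases a h s k i₀ j₀ q₁ q₂ ρ ε₁ x i A u with
      ⟨n, e, f, hc, hdu, hbu⟩ | ⟨-, hbu⟩ <;>
    rcases blockShift_cases a h s k i₀ j₀ q₁ q₂ ρ ε₁ x i A v with
      ⟨n', e', f', hc', hdv, hbv⟩ | ⟨-, hbv⟩
  · -- both displaced: different registry signs, hence different layers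
    have hnn : n ≠ n' := by
      rintro rfl
      exact hd (hbu.trans hbv.symm)
    rw [hbu, hbv] at huv
    set z := barlowPos a h s k i₀ j₀ with hz
    have h1 : dist (x u + A ((shiftSign s q₁ n : ℝ) • barlowOffset a))
        (x i + A (barlowPos a h s n e f + (shiftSign s q₁ n : ℝ) • barlowOffset a - z)) ≤ ε₁ := by
      rw [dist_add_chart_eq]; exact hdu
    have h2 : dist (x v + A ((shiftSign s q₁ n' : ℝ) • barlowOffset a))
        (x i + A (barlowPos a h s n' e' f' + (shiftSign s q₁ n' : ℝ) • barlowOffset a - z)) ≤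
          ε₁ := by
      rw [dist_add_chart_eq]; exact hdv
    rw [huv] at h1
    have h3 : dist (barlowPos a h s n e f + (shiftSign s q₁ n : ℝ) • barlowOffset a)
        (barlowPos a h s n' e' f' + (shiftSign s q₁ n' : ℝ) • barlowOffset a) ≤ 2 * ε₁ := by
      rw [← dist_chart_eq (x i) z _ _ A]
      refine (dist_triangle_left _ _ (x v + A ((shiftSign s q₁ n' : ℝ) • barlowOffset a))).trans ?_
      linarith
    have h4 := le_dist_barlowPos_add_smul_of_ne (a := a) hh s (shiftSign s q₁ n : ℝ)
      (shiftSign s q₁ n' : ℝ) hnn e f e' f'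
    obtain ⟨ha0, -, hh0, -⟩ := hbox
    linarith
  · -- `u` displaced, `v` not
    rw [hbu, hbv, add_zero] at huv
    rcases shiftSign_cases s q₁ n with h0 | hσ
    · exact hd (by rw [hbu, hbv, h0, Int.cast_zero, zero_smul, map_zero])
    · exact no_oneSided_collision hbox hε hρ hL hT hc hdu hσ huv
  · -- `v` displaced, `u` not
    rw [hbu, hbv, add_zero] at huv
    rcases shiftSign_cases s q₁ n' with h0 | hσ
    · exact hd (by rw [hbu, hbv, h0, Int.cast_zero, zero_smul, map_zero])
    · exact no_oneSided_collision hbox hε hρ hL hT hc' hdv hσ huv.symm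
  · -- neither displaced
    exact hd (hbu.trans hbv.symm)

end Summit.AtomisticToContinuum.Crystallization.Theorems.SquareWellLayerCake.StackingFaultSparsity
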